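import Summits.CriticalPhenomena.PercolationContinuityZ3.Theorems.Transplant.PlanarSkeletonTwistedFrames
import Summits.CriticalPhenomena.PercolationContinuityZ3.Theorems.Transplant.CayleyHantzscheWendtParity
import HarnessLib

/-!
# `θ(p_c) = 0` on the Cayley graph of the HANTZSCHE–WENDT group `P2₁2₁2₁` w.r.t. its two screw generators — a group with FIRST BETTI NUMBER ZERO —
# UNCONDITIONALLY, through the sign-twisted cocycle chart (`CayleyTwist`, closed `(ℤ/2)²` node)

builds on p205010 (kernel theorem, internal audit signed; external expert review pending): `HW.criticalContinuity` runs through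
`CayleyTwist.criticalContinuity` (`PlanarSkeletonTwistedFrames`), i.e. through the CLOSED node `samePDropOfSkeletonSign_holds`, whose proof uses
near-one gluing (AdditiveGluing), which builds on p205010.  NOTHING is claimed about the open frames-only nodes.
Lane `prim-bschramm`, seat `prim-bschramm-p4` (gen 20; PART C3, `HOME/bschramm/P4-GENERAL.md` §42).  Helper file
(`--supports stmt-CriticalPhenomena-4575 --as helper`).

WHAT THIS SHOWS.  The class map's Cayley rows were all ADDITIVE (`φ : Γ → ℤ²` a homomorphism), hence confined to `b₁(Γ) ≥ 2`; the residual
"(d′) `b₁ ≤ 1`" was recorded as the multi-type wall.  For the CLOSED nodes that confinement is an artefact of additivity: the Hantzsche–Wendt group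
`HW = ⟨α, β⟩ ≤ ℤ³ ⋊ {±1}³` has `Hom(HW, ℤ) = 0` (`HW.hom_int_trivial`, file `CayleyHantzscheWendtParity`), yet `Cay(HW; α^{±1}, β^{±1})` carries a
`CayleyTwist` — cocycle chart `chart (v, D) = (v₀, v₁ − δ(D₁))`, sign character `(D₀, D₁)`, `ν`/`κ` = conjugation by the involutions `γ`, `γ′` of
the normaliser, connected cylinders — so **`θ_g(p_c) = 0` at every vertex, unconditionally** (`HW.criticalContinuity`).  Honest scope: as a GRAPH,
`Cay(HW; α^{±1}, β^{±1})` is the diamond net (R-level; p2's net-level `PlanarSkeletonSign` already covers dia); what is new is the INPUT SENTENCE —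
the unconditional tier needs a rank-two homomorphism `Γ → D_∞²`, not `Γ → ℤ²`, and (d′) is a frames-only phenomenon.
* §1 the symmetric alphabet `S = {a, a⁻¹, b, b⁻¹} ⊂ HW`, adjacency in `Cay(HW; S)`;
* §2 steps everywhere (`step`), descent to the fibre inside a cylinder (`exists_reachable_fibre`);
* §3 the vertical translation `t = β⁻¹α⁻¹β⁻¹α⁻¹ = ((0,0,2), 1)`, `t^m = ((0,0,2m), 1)`, the unit-cylinder path `x → xβ⁻¹ → xβ⁻¹α⁻¹ → xβ⁻¹α⁻¹β⁻¹ → xt`,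
  **`cyl_connected`** ((κ): every cylinder `{‖chart‖_∞ ≤ ℓ}`, `ℓ ≥ 1`, is connected — fibre = `{t^m}` by `HW.eq_vertical`);
* §4 **`HW.twist : CayleyTwist HW S`** and **`HW.criticalContinuity`**.
[cite: BenjaminiSchramm1996, Conj. 4; §2 (Cayley graphs)] [cite: KozmaNitzan2024, §1 p. 2 (approach 1); §4 p. 16 (Lemma 8)]
[cite: Szczepanski2012, §3.3 (Γ₉ = ⟨(B₁,(½,½,0)), (B₂,(0,½,½))⟩, the didicosm c22 = 𝒢₆ = Hantzsche–Wendt); Ch. 4 Def. 4.1 (b₁); Ch. 9]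
[cite: ConwaySloane1999, Ch. 4 §6.1 (the diamond packing as a union of two cosets)]
-/

noncomputable section

namespace Summit.CriticalPhenomena.PercolationContinuityZ3.Theorems.Transplant

open MeasureTheory SimpleGraph Literature.Probability.LatticeModels Literature.Probability.Percolation
open scoped Classical

namespace HW

/-! ## §1 The symmetric alphabet inside `HW` and adjacency in the Cayley graph -/

/-- `(a : P) = α`. [folklore] -/
@[simp] theorem coe_a : ((a : Grp) : P) = α := rfl

/-- `(b : P) = β`. [folklore] -/
@[simp] theorem coe_b : ((b : Grp) : P) = β := rfl

/-- The symmetric alphabet `S = {α, α⁻¹, β, β⁻¹}` as a finite subset of `HW`. [folklore] -/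
def S : Finset Grp := {a, a⁻¹, b, b⁻¹}

/-- Membership in `S` is membership of the underlying element in `gens`. [folklore] -/
theorem mem_S_iff (s : Grp) : s ∈ S ↔ (s : P) ∈ gens := by
  simp only [S, Finset.mem_insert, Finset.mem_singleton, gens, Set.mem_insert_iff, Set.mem_singleton_iff, Subtype.ext_iff,
    Subgroup.coe_inv, coe_a, coe_b]

/-- The chart of a generator is a signed unit vector, in particular nonzero. [folklore] -/
theorem chart_ne_zero_of_mem_gens {s : P} (hs : s ∈ gens) : chart s ≠ 0 := by
  simp only [gens, Set.mem_insert_iff, Set.mem_singleton_iff] at hs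
  rcases hs with rfl | rfl | rfl | rfl
  · rw [chart_α]; decide
  · rw [chart_α_inv]; decide
  · rw [chart_β]; decide
  · rw [chart_β_inv]; decide

/-- Generators are not the identity. [folklore] -/
theorem ne_one_of_mem_S {s : Grp} (hs : s ∈ S) : s ≠ 1 := by
  intro h
  have h0 := chart_ne_zero_of_mem_gens ((mem_S_iff s).1 hs)
  rw [h, OneMemClass.coe_one, chart_one] at h0
  exact h0 rfl

/-- Right multiplication by a generator is an edge of `Cay(HW; S)`. [cite: BenjaminiSchramm1996, §2 (Cayley graphs)] -/
theorem adj_mul (g : Grp) {s : Grp} (hs : s ∈ S) : (mulCayley (S : Set Grp)).Adj g (g * s) := by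
  rw [mulCayley_adj]
  refine ⟨fun h => ne_one_of_mem_S hs (mul_left_cancel (a := g) (by rw [mul_one]; exact h.symm)), Or.inl ?_⟩
  rw [inv_mul_cancel_left]; exact Finset.mem_coe.2 hs

/-- For each chart direction and sign there is a generator realising it: `α^{±1} ↦ ±e₀`, `β^{±1} ↦ ±e₁`. [folklore] -/
theorem exists_gen (i : Fin 2) (σ : ℤˣ) : ∃ s ∈ S, chart (s : P) = Pi.single i (σ : ℤ) := by
  fin_cases i <;> rcases Int.units_eq_one_or σ with rfl | rfl
  · exact ⟨a, by simp [S], by rw [Units.val_one]; exact chart_α⟩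
  · exact ⟨a⁻¹, by simp [S], by rw [Units.val_neg, Units.val_one]; exact chart_α_inv⟩
  · exact ⟨b, by simp [S], by rw [Units.val_one]; exact chart_β⟩
  · exact ⟨b⁻¹, by simp [S], by rw [Units.val_neg, Units.val_one]; exact chart_β_inv⟩

/-! ## §2 Steps everywhere and descent to the fibre inside a cylinder -/

/-- **(ι) everywhere**: at every `g ∈ HW` the four unit steps `chart(g s) = chart g ± e_i` are realised by generators (the step of `s` at `g` is
`sgn g • chart s`, and `sgn g` permutes `{±e_i}`). [cite: KozmaNitzan2024, §4 p. 15 (outward steps)] -/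
theorem step (g : Grp) (i : Fin 2) (σ : ℤˣ) :
    ∃ g' : Grp, (mulCayley (S : Set Grp)).Adj g g' ∧ chart (g' : P) = chart (g : P) + Pi.single i (σ : ℤ) := by
  obtain ⟨s, hs, hφs⟩ := exists_gen i (sgn (g : P) i * σ)
  refine ⟨g * s, adj_mul g hs, ?_⟩
  rw [Subgroup.coe_mul, chart_mul, hφs]
  congr 1
  funext j
  rcases eq_or_ne j i with rfl | hj
  · rw [Pi.single_eq_same, Pi.single_eq_same, Units.val_mul, ← mul_assoc]
    rcases Int.units_eq_one_or (sgn (g : P) j) with h | h <;> simp [h]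
  · simp [Pi.single_eq_of_ne hj]

/-- The cylinder of half-width `ℓ` at the identity: `{g ∈ HW | ‖chart g‖_∞ ≤ ℓ}`. [cite: KozmaNitzan2024, §4 p. 15 (boxes)] -/
def cylSet (ℓ : ℕ) : Set Grp := {g | chart (g : P) ∈ box 2 ℓ}

/-- **Descent**: inside a cylinder every vertex is joined, INSIDE the cylinder, to a vertex of the fibre `chart = 0` (decrease `|d₀| + |d₁|` by unit
steps). [folklore] -/
theorem exists_reachable_fibre (ℓ : ℕ) (w : Grp) (hw : w ∈ cylSet ℓ) :
    ∃ (w₀ : Grp) (h₀ : w₀ ∈ cylSet ℓ), chart (w₀ : P) = 0 ∧ ((mulCayley (S : Set Grp)).induce (cylSet ℓ)).Reachable ⟨w, hw⟩ ⟨w₀, h₀⟩ := by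
  suffices H : ∀ n : ℕ, ∀ (w : Grp) (hw : w ∈ cylSet ℓ), (chart (w : P) 0).natAbs + (chart (w : P) 1).natAbs = n →
      ∃ (w₀ : Grp) (h₀ : w₀ ∈ cylSet ℓ), chart (w₀ : P) = 0 ∧
        ((mulCayley (S : Set Grp)).induce (cylSet ℓ)).Reachable ⟨w, hw⟩ ⟨w₀, h₀⟩ from H _ w hw rfl
  intro n
  induction n using Nat.strong_induction_on with
  | _ n ih =>
    intro w hw hn
    set d : Site 2 := chart (w : P) with hd_def
    have hbox : ∀ j, -(ℓ : ℤ) ≤ d j ∧ d j ≤ ℓ := mem_box.1 hw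
    by_cases h0 : d 0 = 0 ∧ d 1 = 0
    · refine ⟨w, hw, ?_, Reachable.refl _⟩
      have hd0 : d = 0 := by funext j; fin_cases j; exacts [h0.1, h0.2]
      rw [← hd_def]; exact hd0
    obtain ⟨i, hi⟩ : ∃ i : Fin 2, d i ≠ 0 := by
      by_contra hc
      exact h0 ⟨not_not.1 fun h => hc ⟨0, h⟩, not_not.1 fun h => hc ⟨1, h⟩⟩
    obtain ⟨s, hs1, hlt, hrange⟩ : ∃ s : ℤ, (s = 1 ∨ s = -1) ∧ (d i + s).natAbs < (d i).natAbs ∧ (-(ℓ : ℤ) ≤ d i + s ∧ d i + s ≤ ℓ) := by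
      have hb := hbox i
      rcases lt_or_gt_of_ne hi with hlt | hgt
      · exact ⟨1, Or.inl rfl, by omega, by omega⟩
      · exact ⟨-1, Or.inr rfl, by omega, by omega⟩
    obtain ⟨σ, hσ⟩ : ∃ σ : ℤˣ, (σ : ℤ) = s := by
      rcases hs1 with rfl | rfl
      exacts [⟨1, rfl⟩, ⟨-1, rfl⟩]
    obtain ⟨v', hadj, hφ⟩ := step w i σ
    have hdiff : chart (v' : P) = d + Pi.single i s := by rw [hφ, hσ]
    have hv' : v' ∈ cylSet ℓ := by
      show chart (v' : P) ∈ box 2 ℓ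
      rw [mem_box]
      intro j
      rw [hdiff, Pi.add_apply]
      by_cases hj : j = i
      · subst hj; rw [Pi.single_eq_same]; exact hrange
      · rw [Pi.single_eq_of_ne hj, add_zero]; exact hbox j
    have hlt' : (chart (v' : P) 0).natAbs + (chart (v' : P) 1).natAbs < n := by
      rw [← hn, hdiff]
      fin_cases i <;> simp at hlt ⊢ <;> omega
    obtain ⟨w₀, h₀, hφ₀, hreach⟩ := ih _ hlt' v' hv' rfl
    exact ⟨w₀, h₀, hφ₀, (show ((mulCayley (S : Set Grp)).induce (cylSet ℓ)).Adj ⟨w, hw⟩ ⟨v', hv'⟩ from hadj).reachable.trans hreach⟩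

/-! ## §3 The vertical translations and the unit-cylinder path; (κ) -/

/-- The vertical translation `t := β⁻¹ α⁻¹ β⁻¹ α⁻¹ ∈ HW`. [folklore] -/
def tG : Grp := b⁻¹ * a⁻¹ * b⁻¹ * a⁻¹

/-- `t = ((0,0,2), 1)`: a pure translation by twice the vertical period. [folklore] -/
theorem coe_tG : ((tG : Grp) : P) = mk ![0, 0, 2] 1 := by
  simp only [tG, Subgroup.coe_mul, Subgroup.coe_inv, coe_a, coe_b, α, β, mk_mul_mk, mk_inv]
  refine congrArg₂ mk ?_ ?_ <;> funext i <;> fin_cases i <;> simp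

/-- `t^m = ((0,0,2m), 1)`. [folklore] -/
theorem coe_tG_zpow (m : ℤ) : ((tG ^ m : Grp) : P) = mk ![0, 0, 2 * m] 1 := by
  rw [SubgroupClass.coe_zpow, coe_tG]
  show (SemidirectProduct.inl (Multiplicative.ofAdd ![0, 0, 2]) : P) ^ m =
    SemidirectProduct.inl (Multiplicative.ofAdd ![0, 0, 2 * m])
  rw [← map_zpow, ← ofAdd_zsmul]
  congr 2
  funext i; fin_cases i <;> simp [mul_comm]

/-- The chart of `mk v D`. [folklore] -/
theorem chart_mk (v : Site 3) (D : K3) : chart (mk v D) = ![v 0, v 1 - δ (D 1)] := rfl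

/-- `chart (t^m) = 0`. [folklore] -/
theorem chart_tG_zpow (m : ℤ) : chart ((tG ^ m : Grp) : P) = 0 := by
  rw [coe_tG_zpow, chart_mk]
  funext i; fin_cases i <;> simp

/-- `sgn (t^m) = 1`. [folklore] -/
theorem sgn_tG_zpow (m : ℤ) : sgn ((tG ^ m : Grp) : P) = 1 := by
  rw [coe_tG_zpow]; rfl

/-- At a vertex of the fibre with trivial signs, right multiplication does not move the chart: `chart (x w) = chart w`. [folklore] -/
theorem chart_mul_of_base {x : P} (hx0 : chart x = 0) (hx1 : sgn x = 1) (w : P) : chart (x * w) = chart w := by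
  rw [chart_mul, hx0, hx1, zero_add]
  funext i; simp

/-- A vector with entries of absolute value `≤ 1` lies in every box `Λ_ℓ`, `ℓ ≥ 1`. [folklore] -/
theorem mem_box_of_abs_le {y : Site 2} (hy : ∀ i, |y i| ≤ 1) {ℓ : ℕ} (hℓ : 1 ≤ ℓ) : y ∈ box 2 ℓ := by
  rw [mem_box]
  intro i
  have h := abs_le.1 (hy i)
  constructor <;> omega

/-- Charts of the partial words of `t`: `β⁻¹ ↦ (0,−1)`, `β⁻¹α⁻¹ ↦ (1,−1)`, `β⁻¹α⁻¹β⁻¹ ↦ (1,0)` — all of sup-norm `≤ 1`. [folklore] -/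
theorem abs_chart_partial_le :
    (∀ i, |chart (β⁻¹) i| ≤ 1) ∧ (∀ i, |chart (β⁻¹ * α⁻¹) i| ≤ 1) ∧ (∀ i, |chart (β⁻¹ * α⁻¹ * β⁻¹) i| ≤ 1) := by
  simp only [α, β, mk_mul_mk, mk_inv]
  exact ⟨by decide, by decide, by decide⟩

/-- **The unit-cylinder path `x → xβ⁻¹ → xβ⁻¹α⁻¹ → xβ⁻¹α⁻¹β⁻¹ → x t`** from a fibre vertex with trivial signs, inside every cylinder `Λ_ℓ`, `ℓ ≥ 1`.
[cite: KozmaNitzan2024, §4 p. 15 (connected cylinders)] -/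
theorem reach_mul_tG {ℓ : ℕ} (hℓ : 1 ≤ ℓ) (x : Grp) (hx0 : chart (x : P) = 0) (hx1 : sgn (x : P) = 1) (hx : x ∈ cylSet ℓ) :
    ∃ h' : x * tG ∈ cylSet ℓ, ((mulCayley (S : Set Grp)).induce (cylSet ℓ)).Reachable ⟨x, hx⟩ ⟨x * tG, h'⟩ := by
  obtain ⟨c1, c2, c3⟩ := abs_chart_partial_le
  have hb : (b⁻¹ : Grp) ∈ S := by simp [S]
  have ha : (a⁻¹ : Grp) ∈ S := by simp [S]
  -- the three intermediate vertices and the endpoint lie in the cylinder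
  have m1 : x * b⁻¹ ∈ cylSet ℓ := by
    show chart ((x * b⁻¹ : Grp) : P) ∈ box 2 ℓ
    rw [Subgroup.coe_mul, chart_mul_of_base hx0 hx1]; exact mem_box_of_abs_le c1 hℓ
  have m2 : x * b⁻¹ * a⁻¹ ∈ cylSet ℓ := by
    show chart ((x * b⁻¹ * a⁻¹ : Grp) : P) ∈ box 2 ℓ
    rw [mul_assoc, Subgroup.coe_mul, chart_mul_of_base hx0 hx1]; exact mem_box_of_abs_le c2 hℓ
  have m3 : x * b⁻¹ * a⁻¹ * b⁻¹ ∈ cylSet ℓ := by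
    show chart ((x * b⁻¹ * a⁻¹ * b⁻¹ : Grp) : P) ∈ box 2 ℓ
    rw [mul_assoc, mul_assoc, Subgroup.coe_mul, chart_mul_of_base hx0 hx1, ← mul_assoc]; exact mem_box_of_abs_le c3 hℓ
  have e4 : x * b⁻¹ * a⁻¹ * b⁻¹ * a⁻¹ = x * tG := by simp only [tG, mul_assoc]
  have m4 : x * tG ∈ cylSet ℓ := by
    show chart ((x * tG : Grp) : P) ∈ box 2 ℓ
    rw [Subgroup.coe_mul, chart_mul_of_base hx0 hx1, show (tG : Grp) = tG ^ (1 : ℤ) by rw [zpow_one], chart_tG_zpow]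
    exact zero_mem_box 2 ℓ
  refine ⟨m4, ?_⟩
  have s1 : ((mulCayley (S : Set Grp)).induce (cylSet ℓ)).Adj ⟨x, hx⟩ ⟨x * b⁻¹, m1⟩ := adj_mul x hb
  have s2 : ((mulCayley (S : Set Grp)).induce (cylSet ℓ)).Adj ⟨x * b⁻¹, m1⟩ ⟨x * b⁻¹ * a⁻¹, m2⟩ := adj_mul _ ha
  have s3 : ((mulCayley (S : Set Grp)).induce (cylSet ℓ)).Adj ⟨x * b⁻¹ * a⁻¹, m2⟩ ⟨x * b⁻¹ * a⁻¹ * b⁻¹, m3⟩ := adj_mul _ hb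
  have s4 : ((mulCayley (S : Set Grp)).induce (cylSet ℓ)).Adj ⟨x * b⁻¹ * a⁻¹ * b⁻¹, m3⟩ ⟨x * tG, m4⟩ := by
    have h := adj_mul (x * b⁻¹ * a⁻¹ * b⁻¹) ha
    rw [e4] at h
    exact h
  exact s1.reachable.trans (s2.reachable.trans (s3.reachable.trans s4.reachable))

/-- **Every vertical translation `t^m` is joined to `1` inside every cylinder `Λ_ℓ`, `ℓ ≥ 1`.** [folklore] -/
theorem reach_zpow {ℓ : ℕ} (hℓ : 1 ≤ ℓ) (h1 : (1 : Grp) ∈ cylSet ℓ) (m : ℤ) :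
    ∃ hm : tG ^ m ∈ cylSet ℓ, ((mulCayley (S : Set Grp)).induce (cylSet ℓ)).Reachable ⟨1, h1⟩ ⟨tG ^ m, hm⟩ := by
  induction m using Int.induction_on with
  | zero => rw [zpow_zero]; exact ⟨h1, Reachable.refl _⟩
  | succ i ih =>
    obtain ⟨hm, hr⟩ := ih
    obtain ⟨h', hr'⟩ := reach_mul_tG hℓ (tG ^ (i : ℤ)) (chart_tG_zpow _) (sgn_tG_zpow _) hm
    have e : tG ^ (i : ℤ) * tG = tG ^ ((i : ℤ) + 1) := (zpow_add_one tG i).symm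
    have hm' : tG ^ ((i : ℤ) + 1) ∈ cylSet ℓ := by rw [← e]; exact h'
    have ept : (⟨tG ^ (i : ℤ) * tG, h'⟩ : cylSet ℓ) = ⟨tG ^ ((i : ℤ) + 1), hm'⟩ := Subtype.ext e
    rw [ept] at hr'
    exact ⟨hm', hr.trans hr'⟩
  | pred i ih =>
    obtain ⟨hm, hr⟩ := ih
    have e : tG ^ (-(i : ℤ) - 1) * tG = tG ^ (-(i : ℤ)) := by
      rw [← zpow_add_one]; congr 1; ring
    have hm' : tG ^ (-(i : ℤ) - 1) ∈ cylSet ℓ := by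
      show chart ((tG ^ (-(i : ℤ) - 1) : Grp) : P) ∈ box 2 ℓ; rw [chart_tG_zpow]; exact zero_mem_box 2 ℓ
    obtain ⟨h', hr'⟩ := reach_mul_tG hℓ (tG ^ (-(i : ℤ) - 1)) (chart_tG_zpow _) (sgn_tG_zpow _) hm'
    have ept : (⟨tG ^ (-(i : ℤ) - 1) * tG, h'⟩ : cylSet ℓ) = ⟨tG ^ (-(i : ℤ)), hm⟩ := Subtype.ext e
    rw [ept] at hr'
    exact ⟨hm', hr.trans hr'.symm⟩

/-- **(κ) for `Cay(HW; S)`: every cylinder `{‖chart‖_∞ ≤ ℓ}`, `ℓ ≥ 1`, induces a CONNECTED subgraph** (descend to the fibre, which is `{t^m}` by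
the parity invariant, and the `t^m` are chained through the identity). [cite: KozmaNitzan2024, §4 p. 15 (connected cylinders)] -/
theorem cyl_connected (ℓ : ℕ) (hℓ : 1 ≤ ℓ) : ((mulCayley (S : Set Grp)).induce (cylSet ℓ)).Connected := by
  have h1 : (1 : Grp) ∈ cylSet ℓ := by
    show chart ((1 : Grp) : P) ∈ box 2 ℓ
    rw [OneMemClass.coe_one, chart_one]; exact zero_mem_box 2 ℓ
  haveI : Nonempty (cylSet ℓ) := ⟨⟨1, h1⟩⟩
  have key : ∀ w : cylSet ℓ, ((mulCayley (S : Set Grp)).induce (cylSet ℓ)).Reachable ⟨1, h1⟩ w := by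
    rintro ⟨w, hw⟩
    obtain ⟨w₀, h₀, hφ, hr⟩ := exists_reachable_fibre ℓ w hw
    obtain ⟨m, hm⟩ := eq_vertical w₀.2 hφ
    have e : w₀ = tG ^ m := Subtype.ext (by rw [hm, coe_tG_zpow])
    subst e
    obtain ⟨hm', hr'⟩ := reach_zpow hℓ h1 m
    exact hr'.trans hr.symm
  exact ⟨fun u v => (key u).symm.trans (key v)⟩

/-! ## §4 The `CayleyTwist` instance and the theorem -/

/-- `ν` preserves the alphabet. [folklore] -/
theorem ν_mem_S (s : Grp) : ν s ∈ S ↔ s ∈ S := by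
  rw [mem_S_iff, mem_S_iff, show ((ν s : Grp) : P) = γ * s * γ from rfl]
  constructor
  · intro h
    have h' := γ_gens _ h
    rwa [show γ * (γ * (s : P) * γ) * γ = s by
      rw [show γ * (γ * (s : P) * γ) * γ = (γ * γ) * s * (γ * γ) by group, γ_mul_γ]; group] at h'
  · exact γ_gens _

/-- `κ` preserves the alphabet. [folklore] -/
theorem κ_mem_S (s : Grp) : κ s ∈ S ↔ s ∈ S := by
  rw [mem_S_iff, mem_S_iff, show ((κ s : Grp) : P) = γ' * s * γ' from rfl]
  constructor
  · intro h
    have h' := γ'_gens _ h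
    rwa [show γ' * (γ' * (s : P) * γ') * γ' = s by
      rw [show γ' * (γ' * (s : P) * γ') * γ' = (γ' * γ') * s * (γ' * γ') by group, γ'_mul_γ']; group] at h'
  · exact γ'_gens _

/-- **THE TWISTED CAYLEY DATUM OF THE HANTZSCHE–WENDT GROUP**: cocycle chart `chart`, sign character `sgn`, unit range and unit steps on
`S = {α^{±1}, β^{±1}}`, `ν = γ(·)γ` acting by `−I`, `κ = γ′(·)γ′` acting by `diag(1,−1)`, connected cylinders.
[cite: KozmaNitzan2024, §4 p. 16 (Lemma 8: the lattice symmetries)] [cite: BenjaminiSchramm1996, §2 (Cayley graphs)] -/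
def twist : CayleyTwist Grp S where
  ε := sgn.comp Grp.subtype
  φ := fun g => chart (g : P)
  twist := fun g h => by
    show chart ((g * h : Grp) : P) = chart (g : P) + sgnMul (sgn (g : P)) (chart (h : P))
    rw [Subgroup.coe_mul, chart_mul]; rfl
  lip := fun s hs i => chart_gens_le ((mem_S_iff s).1 hs) i
  step := fun i σ => by
    obtain ⟨s, hs, hφ⟩ := exists_gen i σ
    refine ⟨s, ?_, hφ⟩
    have h := adj_mul 1 hs
    rwa [one_mul] at h
  ν := ν
  ν_mem := ν_mem_S
  ν_φ := fun g => chart_conj_γ (g : P)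
  κ := κ
  κ_mem := κ_mem_S
  κ_φ := fun g => chart_conj_γ' (g : P)
  cyl_connected := cyl_connected

/-- **THEOREM (unconditional).  `θ_g(p_c) = 0` at every vertex of the Cayley graph of the Hantzsche–Wendt group `HW = P2₁2₁2₁` w.r.t. the screw
generators `{α^{±1}, β^{±1}}`** — a finitely generated group with FIRST BETTI NUMBER ZERO (`HW.hom_int_trivial`), i.e. outside every additive
Cayley row of the class map, reached by the sign-twisted cocycle chart through the closed `(ℤ/2)²` node.  (As a graph this is the diamond net —
R-level identification; the new content is the input sentence, not the graph.)
builds on p205010 (kernel theorem, internal audit signed; external expert review pending).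
[cite: BenjaminiSchramm1996, Conj. 4; §2] [cite: KozmaNitzan2024, §1 p. 2 (approach 1)] [cite: Szczepanski2012, §3.3 (Γ₉, the didicosm); Ch. 9] -/
theorem criticalContinuity (g : Grp) :
    theta (mulCayley (↑S : Set Grp)) g (criticalProbIOf (mulCayley (↑S : Set Grp)) g) = 0 :=
  twist.criticalContinuity g

end HW

end Summit.CriticalPhenomena.PercolationContinuityZ3.Theorems.Transplant

end
-- build-touch 2026-08-25T07:43:26Z T1-B (lead g18): re-land of p391565, declarations byte-identical
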